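import Summits.QuantumFields.BalabanUV.Beta.SymAveragingHessianCountsBounds
import Literature.MathematicalPhysics.QuantumFieldTheory.Balaban1983to89.Beta.AveragingMixedJetTables

/-!
# `BalabanUV.Beta.SymAveragingMixedJetTables` — binder row D1, TABLES-SYM step S2b (an1): THE (0.4)-SYMMETRISED GROUP-LEVEL AVERAGING
# `symPhiGAt` OVER THE `(σ,σ′)`-PAIR LOOP WORDS, ITS JETS `symQjetAt ∕ symT2At ∕ symMjetAt`, AND (parts 2–3) THE SECOND-ORDER TABLES
# `symMixFFAt` ∕ `symVh₂SAt` WITH THEIR LETTERS (Lmix)(Tmix)(LB)(TB) — part 1: words and jets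

HONEST FRAMING (cell contract, verbatim): «discharging `BetaPertH` makes Bałaban's UV stability UNCONDITIONAL — a real constructive-QFT
result; it is NOT the continuum limit and NOT the Clay problem.»  THIS MODULE DISCHARGES NOTHING of `BetaPertH` ∕ row D1: it is [folklore]
letter algebra in node 12's truncated formal calculus — the `S_d × S_d` version of node 12b `Beta.AveragingMixedJetTables` §1–§4 (same section
plan, same proofs, with node 5ρ's rooted comb loops `loopCAt ρ` replaced by S2a's pair loops `loopPAt σ σ′ ρ` and the block mean `L^{−d} Σ_x` by the
(0.4) mean `((d!)² L^d)^{−1} Σ_x Σ_{σ,σ′}`).  0 sorry, 0 `def … : Prop`, nothing cited as a fact; quotations are OBJECT LOCATORS only.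
NOT D1, NOT BetaPertH, NOT continuum, NOT Clay.

WHY.  The (0.4) literal of row D1 (`SymmetrisedStepJets.SymTables`, RULINGS R-D1-g25-1∕-2, R-D1-g30-1 (A)) consumes FIVE symmetrised tables.  S2a
(`SymAveragingHessianCounts*`) typed the first-order ones (`V`, `H`) with their letters; the owner's record `SymTablesAn1FirstOrder.symTablesAn1`
still DISPLAYS the second-order tables `vh₂S`, `mixFF` and their four letters as arguments (referee «second-order tables 0∕2»).  The (0.4)
average is the exponential of the MEAN OF LOGARITHMS over the contour family `{Γ^σ_{c₋,x} ∪ [x,x′] ∪ (Γ^{σ′}_{c₊,x′})⁻¹}` ([Balaban1987RG1] (0.4)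
p. 253, weights `|G(c₋,x)|⁻¹·|G(c₊,x′)|⁻¹`; a contour moving `m` axes arises from `d!∕m!` orders, so the uniform mean over orders IS the mean over
`G` — [analysis], as in S2a) — i.e. EXACTLY node 12's `PhiG` with the larger family; at second order the cross terms `σ ≠ σ′` do not drop
(R-D1-g25-1 (4)(R1)), so the tables are NOT `S_d`-means of comb tables and must be extracted from this word.

WHAT (part 1; [folklore] throughout; «sym twin of X» = X of node 12b with `PhiGAt ↦ symPhiGAt`):
* §1 every letter of a pair word is an oriented bond letter (any root): `lettersIn_gammaPAt_top`, `lettersIn_loopPAt_top`.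
* §2 `symPhiGAt 𝕜 ρ G Ḡ L μ y := expT(((d!)²L^d)⁻¹ • Σ_{x∈B(y)} Σ_{σ,σ′} logT hol(loop^{σ,σ′,ρ}_x)) · hol(c)`, `c = [L·y+ρ, L·y+ρ+L·e_μ]`;
  naturality `map_symPhiGAt`, triviality `symPhiGAt_one`, congruence `symPhiGAt_congr(_near)`, BLOCK TRANSLATION `symPhiGAt_add`.
* §3 node 12's chart: `symPhiRAt`, the averaged jet `symQjetAt` and the symmetrised second-order background response `symT2At`
  (`= c11 (symQjetAt ω B B′) + c11 (symQjetAt ω B′ B)`); translation and congruence.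
* §4 node 12b's mixed chart `U_f = e^{τ₁W_f+τ₂V_f}·e^{σB_f}`: `symPhiMAt`, the right-trivialised mixed jet `symMjetAt`; the three killing
  homomorphisms act through `map_symPhiGAt` (node 12b's letter lemmas `k1_Gm` … BY NAME), so `symMjetAt` VANISHES when a slot is `0`;
  translation and congruence.
Parts 2–3 (`SymAveragingMixedJetStructure`, `SymAveragingMixedJetTables`): slot-by-slot vanishing, the scalar tables by word-coefficient
extraction, support ∕ covariance ∕ finiteness, the packed kernels and their letters.  NOT HERE: any value of any table (an1's exact engine of
record tabulates them OUTSIDE Lean — provenance only), the Ward laws (T2-B)(T2-M₂), reflection letters, any estimate beyond finiteness.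
HONEST DEPENDENCY (verbatim): «continuum YM on T⁴ ⇐ BetaPertH ∧ nine spine estimates (0/9 proved); BetaPertH ⇐ (D1) ∧ (D4) ∧ CAP+tail;
G-an2-4 gates asym, D1 and NE2/3/4.»  ABSOLUTE RULE (cell, verbatim): «No internally-minted statement may enter as a cited fact. Every
hypothesis is either kernel-proved in this package or a verbatim quotation of a PUBLISHED theorem with page reference.»
Provenance: β sub-cell, W-supplier `b2b-balaban-beta-an1` gen 43 (scratch for courier by the row-D1 owner), 2026-08-21; over node 12∕12b, node
5ρ∕7a∕7aρ and S2a BY NAME; no existing file touched.  Bib keys (locators only): Balaban1985Averaging, Balaban1987RG1.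
-/

namespace Summit.QuantumFields.BalabanUV.Beta.SymAveragingMixedJetTables

open Finset
open scoped BigOperators Nat
open Literature.MathematicalPhysics.QuantumFieldTheory.Balaban1983to89.Beta
open Literature.MathematicalPhysics.QuantumFieldTheory.Balaban1983to89.Beta.AffineAveraging
open Literature.MathematicalPhysics.QuantumFieldTheory.Balaban1983to89.Beta.AveragingContours
open Literature.MathematicalPhysics.QuantumFieldTheory.Balaban1983to89.Beta.AveragingContoursRooted
open Literature.MathematicalPhysics.QuantumFieldTheory.Balaban1983to89.Beta.TransportedContourVariables
open Literature.MathematicalPhysics.QuantumFieldTheory.Balaban1983to89.Beta.AveragingHessianKernels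
open Literature.MathematicalPhysics.QuantumFieldTheory.Balaban1983to89.Beta.AveragingHessianKernelsRooted
open Literature.MathematicalPhysics.QuantumFieldTheory.Balaban1983to89.Beta.AveragingThirdJet
open Literature.MathematicalPhysics.QuantumFieldTheory.Balaban1983to89.Beta.AveragingThirdJet.Tau
open Literature.MathematicalPhysics.QuantumFieldTheory.Balaban1983to89.Beta.AveragingMixedJetTables
open Summit.QuantumFields.BalabanUV.Beta.SymAveragingHessianCounts (axialP lettersIn_axialP gammaPAt loopPAt loopPAt_map loopPAt_add
  lettersIn_loopPAt)

noncomputable section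

variable {d : ℕ}

/-! ## §1 Letters of the pair words: oriented bond letters for ANY root -/

section Letters

variable {S : Type*} [AddCommGroup S]

/-- [folklore] Every letter of the rooted pair word `γ^{σ,σ′,ρ}_x` is an oriented bond letter (ANY root `ρ`). -/
theorem lettersIn_gammaPAt_top (σ σ' : Equiv.Perm (Fin d)) (ρ : Fin d → ℤ) (A : Form1 d S) (L : ℕ) (μ : Fin d) (y : Fin d → ℤ)
    (b : Fin d → ℕ) : LettersIn A (fun _ => True) (gammaPAt σ σ' ρ A L μ y b) :=
  (((lettersIn_axialP σ A _ _).mono fun _ _ => trivial).append (lettersIn_segUp_top A _ _ _)).append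
    ((lettersIn_axialP σ' A _ _).mono fun _ _ => trivial).rev

/-- [folklore] Every letter of the rooted closed pair loop is an oriented bond letter (ANY root `ρ`). -/
theorem lettersIn_loopPAt_top (σ σ' : Equiv.Perm (Fin d)) (ρ : Fin d → ℤ) (A : Form1 d S) (L : ℕ) (μ : Fin d) (y : Fin d → ℤ)
    (b : Fin d → ℕ) : LettersIn A (fun _ => True) (loopPAt σ σ' ρ A L μ y b) :=
  (lettersIn_gammaPAt_top σ σ' ρ A L μ y b).append (lettersIn_segUp_top A _ μ L).rev

end Letters

/-! ## §2 The (0.4)-symmetrised rooted one-step averaging `symPhiGAt ρ` on group-valued transporters -/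

section Averaging

variable (𝕜 : Type*) [Field 𝕜] {R R' : Type*} [Ring R] [Algebra 𝕜 R] [Ring R'] [Algebra 𝕜 R']

/-- [our object] **THE (0.4)-SYMMETRISED ROOTED ONE-STEP COVARIANT AVERAGING** in node 12's truncated calculus, for a pair of transporter
assignments `(G, Ḡ)`: `Φ^{ρ,sym}_b = expT( ((d!)²L^d)⁻¹ Σ_{x ∈ B(y)} Σ_{σ,σ′ ∈ S_d} logT hol(loop^{σ,σ′,ρ}_x) ) · hol(c)`, `c = [L·y + ρ, L·y + ρ + L·e_μ]`
— node 12b's `PhiGAt ρ` with S2a's pair loops `loopPAt σ σ′ ρ δ` and the (0.4) weight (sym twin of `PhiGAt`). -/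
def symPhiGAt (ρ : Fin d → ℤ) (G Gb : Form1 d R) (L : ℕ) (μ : Fin d) (y : Fin d → ℤ) : R :=
  expT 𝕜 ((((d ! : 𝕜) ^ 2 * (L : 𝕜) ^ d))⁻¹ • ∑ b ∈ box d L, ∑ σ : Equiv.Perm (Fin d), ∑ σ' : Equiv.Perm (Fin d),
      logT 𝕜 (holG G Gb (loopPAt σ σ' ρ δ L μ y b)))
    * holG G Gb (segUp δ ((L : ℤ) • y + ρ) μ L)

variable {𝕜}

/-- [folklore] NATURALITY of the symmetrised rooted averaging under `𝕜`-algebra maps. -/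
theorem map_symPhiGAt (ψ : R →ₐ[𝕜] R') (ρ : Fin d → ℤ) (G Gb : Form1 d R) (L : ℕ) (μ : Fin d) (y : Fin d → ℤ) :
    ψ (symPhiGAt 𝕜 ρ G Gb L μ y) = symPhiGAt 𝕜 ρ (fun κ x => ψ (G κ x)) (fun κ x => ψ (Gb κ x)) L μ y := by
  simp only [symPhiGAt, map_mul, map_expT, map_smul, map_sum, map_logT, map_holG]

/-- [folklore] The symmetrised rooted averaging of the trivial configuration is trivial. -/
theorem symPhiGAt_one (ρ : Fin d → ℤ) (L : ℕ) (μ : Fin d) (y : Fin d → ℤ) :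
    symPhiGAt 𝕜 ρ (fun _ _ => (1 : R)) (fun _ _ => 1) L μ y = 1 := by
  have h1 : ∀ b ∈ box d L, ∑ σ : Equiv.Perm (Fin d), ∑ σ' : Equiv.Perm (Fin d),
      logT 𝕜 (holG (fun _ _ => (1 : R)) (fun _ _ => 1) (loopPAt σ σ' ρ δ L μ y b)) = 0 := by
    intro b _
    refine Finset.sum_eq_zero fun σ _ => Finset.sum_eq_zero fun σ' _ => ?_
    rw [holG_one (lettersIn_loopPAt_top σ σ' ρ δ L μ y b), logT_one]
  rw [symPhiGAt, Finset.sum_congr rfl h1, Finset.sum_const_zero, smul_zero, expT_zero, one_mul,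
    holG_one (lettersIn_segUp_top δ _ μ L)]

/-- [folklore] CONGRUENCE of the symmetrised rooted averaging: transporter pairs agreeing on every bond based in a region that contains the
letters of all the pair loops and of the coarse bond give the same `Φ^{ρ,sym}_b`. -/
theorem symPhiGAt_congr {P : (Fin d → ℤ) → Prop} (ρ : Fin d → ℤ) {G Gb G' Gb' : Form1 d R} (L : ℕ) (μ : Fin d) (y : Fin d → ℤ)
    (hloop : ∀ b ∈ box d L, ∀ σ σ' : Equiv.Perm (Fin d), LettersIn δ P (loopPAt σ σ' ρ δ L μ y b))
    (hc : LettersIn δ P (segUp δ ((L : ℤ) • y + ρ) μ L)) (hG : ∀ κ x, P x → G κ x = G' κ x)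
    (hGb : ∀ κ x, P x → Gb κ x = Gb' κ x) : symPhiGAt 𝕜 ρ G Gb L μ y = symPhiGAt 𝕜 ρ G' Gb' L μ y := by
  rw [symPhiGAt, symPhiGAt, holG_congr hc hG hGb,
    Finset.sum_congr rfl fun b hb => Finset.sum_congr rfl fun σ _ => Finset.sum_congr rfl fun σ' _ => by
      rw [holG_congr (hloop b hb σ σ') hG hGb]]

/-- [folklore] CONGRUENCE for a root offset in the box: agreement on the bonds based in node 7a's support box `Near L y` suffices. -/
theorem symPhiGAt_congr_near {r : Fin d → ℕ} {L : ℕ} (hr : r ∈ box d L) {G Gb G' Gb' : Form1 d R} (μ : Fin d) (y : Fin d → ℤ)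
    (hG : ∀ κ x, Near L y x → G κ x = G' κ x) (hGb : ∀ κ x, Near L y x → Gb κ x = Gb' κ x) :
    symPhiGAt 𝕜 (toSite r) G Gb L μ y = symPhiGAt 𝕜 (toSite r) G' Gb' L μ y :=
  symPhiGAt_congr (toSite r) L μ y (fun _ hb σ σ' => lettersIn_loopPAt σ σ' δ L μ y hr hb) (lettersIn_cSegAt δ L μ y hr) hG hGb

/-- [folklore] BLOCK TRANSLATION of the symmetrised rooted averaging (the root offset rides along):
`Φ^{ρ,sym}_{(μ, y + v)}(G, Ḡ) = Φ^{ρ,sym}_{(μ, y)}(G(· + L v), Ḡ(· + L v))`. -/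
theorem symPhiGAt_add (ρ : Fin d → ℤ) (G Gb : Form1 d R) (L : ℕ) (μ : Fin d) (y v : Fin d → ℤ) :
    symPhiGAt 𝕜 ρ G Gb L μ (y + v) = symPhiGAt 𝕜 ρ (shift ((L : ℤ) • v) G) (shift ((L : ℤ) • v) Gb) L μ y := by
  have hl : ∀ (σ σ' : Equiv.Perm (Fin d)) (b : Fin d → ℕ),
      loopPAt σ σ' ρ δ L μ (y + v) b = (loopPAt σ σ' ρ δ L μ y b).map (shiftL ((L : ℤ) • v)) := by
    intro σ σ' b; rw [loopPAt_add, ← mapForm_shiftL_δ, loopPAt_map]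
  have hc : segUp δ ((L : ℤ) • (y + v) + ρ) μ L
      = (segUp (δ : Form1 d (LetterGrp d)) ((L : ℤ) • y + ρ) μ L).map (shiftL ((L : ℤ) • v)) := by
    rw [segUp_map, mapForm_shiftL_δ, ← segUp_add]
    congr 1; rw [smul_add]; abel
  rw [symPhiGAt, symPhiGAt, hc, holG_map_shiftL _ _ _ (lettersIn_segUp_top δ _ μ L),
    Finset.sum_congr rfl fun b _ => Finset.sum_congr rfl fun σ _ => Finset.sum_congr rfl fun σ' _ => by
      rw [hl, holG_map_shiftL _ _ _ (lettersIn_loopPAt_top σ σ' ρ δ L μ y b)]]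

end Averaging

/-! ## §3 The symmetrised rooted averaged jet `symQjetAt ρ` (node 12's chart) and the symmetrised `symT2At` -/

section Qjet

variable (𝕜 : Type*) [Field 𝕜] {𝔸 : Type*} [Ring 𝔸] [Algebra 𝕜 𝔸]

/-- [our object] The symmetrised rooted averaging on node 12's product chart `U_f = X_f E_f` (sym twin of `PhiRAt`). -/
def symPhiRAt (ρ : Fin d → ℤ) (ω : Form1 d (Tau 𝔸)) (B B' : Form1 d 𝔸) (L : ℕ) (μ : Fin d) (y : Fin d → ℤ) : Rho 𝔸 :=
  symPhiGAt 𝕜 ρ (Gf ω B B') (Gb ω B B') L μ y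

/-- [our object] THE SYMMETRISED ROOTED AVERAGED JET (sym twin of `QjetAt`): the `ρ`-coefficient of `logT( Φ^{ρ,sym}_b(U) · invT(Φ^{ρ,sym}_b(E)) )`. -/
def symQjetAt (ρ : Fin d → ℤ) (ω : Form1 d (Tau 𝔸)) (B B' : Form1 d 𝔸) (L : ℕ) (μ : Fin d) (y : Fin d → ℤ) : Tau 𝔸 :=
  (logT 𝕜 (symPhiRAt 𝕜 ρ ω B B' L μ y * invT (symPhiRAt 𝕜 ρ 0 B B' L μ y))).snd

/-- [our object] THE SYMMETRISED SECOND-ORDER BACKGROUND RESPONSE of the (0.4) averaging (sym twin of `T2At`):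
`symT2At ρ ω B B′ = c11 (symQjetAt ρ ω B B′) + c11 (symQjetAt ρ ω B′ B)`. -/
def symT2At (ρ : Fin d → ℤ) (ω : Form1 d (Tau 𝔸)) (B B' : Form1 d 𝔸) (L : ℕ) (μ : Fin d) (y : Fin d → ℤ) : 𝔸 :=
  c11 (symQjetAt 𝕜 ρ ω B B' L μ y) + c11 (symQjetAt 𝕜 ρ ω B' B L μ y)

/-- [folklore] `symT2At` is symmetric in the two backgrounds (by construction). -/
theorem symT2At_symm (ρ : Fin d → ℤ) (ω : Form1 d (Tau 𝔸)) (B B' : Form1 d 𝔸) (L : ℕ) (μ : Fin d) (y : Fin d → ℤ) :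
    symT2At 𝕜 ρ ω B' B L μ y = symT2At 𝕜 ρ ω B B' L μ y := add_comm _ _

/-- [folklore] BLOCK TRANSLATION of `symPhiRAt`. -/
theorem symPhiRAt_add (ρ : Fin d → ℤ) (ω : Form1 d (Tau 𝔸)) (B B' : Form1 d 𝔸) (L : ℕ) (μ : Fin d) (y v : Fin d → ℤ) :
    symPhiRAt 𝕜 ρ ω B B' L μ (y + v)
      = symPhiRAt 𝕜 ρ (shift ((L : ℤ) • v) ω) (shift ((L : ℤ) • v) B) (shift ((L : ℤ) • v) B') L μ y := by
  rw [symPhiRAt, symPhiGAt_add]; rfl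

/-- [folklore] BLOCK TRANSLATION of the symmetrised rooted jet. -/
theorem symQjetAt_add (ρ : Fin d → ℤ) (ω : Form1 d (Tau 𝔸)) (B B' : Form1 d 𝔸) (L : ℕ) (μ : Fin d) (y v : Fin d → ℤ) :
    symQjetAt 𝕜 ρ ω B B' L μ (y + v)
      = symQjetAt 𝕜 ρ (shift ((L : ℤ) • v) ω) (shift ((L : ℤ) • v) B) (shift ((L : ℤ) • v) B') L μ y := by
  rw [symQjetAt, symQjetAt, symPhiRAt_add, symPhiRAt_add]; rfl

/-- [folklore] BLOCK TRANSLATION of `symT2At`. -/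
theorem symT2At_add (ρ : Fin d → ℤ) (ω : Form1 d (Tau 𝔸)) (B B' : Form1 d 𝔸) (L : ℕ) (μ : Fin d) (y v : Fin d → ℤ) :
    symT2At 𝕜 ρ ω B B' L μ (y + v)
      = symT2At 𝕜 ρ (shift ((L : ℤ) • v) ω) (shift ((L : ℤ) • v) B) (shift ((L : ℤ) • v) B') L μ y := by
  rw [symT2At, symT2At, symQjetAt_add, symQjetAt_add]

/-- [folklore] CONGRUENCE of `symPhiRAt` for a root offset in the box. -/
theorem symPhiRAt_congr_near {r : Fin d → ℕ} {L : ℕ} (hr : r ∈ box d L) {ω ω' : Form1 d (Tau 𝔸)} {B B₁ B' B₁' : Form1 d 𝔸}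
    (μ : Fin d) (y : Fin d → ℤ) (hω : ∀ κ x, Near L y x → ω κ x = ω' κ x) (hB : ∀ κ x, Near L y x → B κ x = B₁ κ x)
    (hB' : ∀ κ x, Near L y x → B' κ x = B₁' κ x) :
    symPhiRAt 𝕜 (toSite r) ω B B' L μ y = symPhiRAt 𝕜 (toSite r) ω' B₁ B₁' L μ y :=
  symPhiGAt_congr_near hr μ y (fun κ x hx => by simp only [Gf, Ebg, hω κ x hx, hB κ x hx, hB' κ x hx])
    (fun κ x hx => by simp only [Gb, Ebi, hω κ x hx, hB κ x hx, hB' κ x hx])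

/-- [folklore] CONGRUENCE of the symmetrised rooted jet for a root offset in the box. -/
theorem symQjetAt_congr_near {r : Fin d → ℕ} {L : ℕ} (hr : r ∈ box d L) {ω ω' : Form1 d (Tau 𝔸)} {B B₁ B' B₁' : Form1 d 𝔸}
    (μ : Fin d) (y : Fin d → ℤ) (hω : ∀ κ x, Near L y x → ω κ x = ω' κ x) (hB : ∀ κ x, Near L y x → B κ x = B₁ κ x)
    (hB' : ∀ κ x, Near L y x → B' κ x = B₁' κ x) :
    symQjetAt 𝕜 (toSite r) ω B B' L μ y = symQjetAt 𝕜 (toSite r) ω' B₁ B₁' L μ y := by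
  rw [symQjetAt, symQjetAt, symPhiRAt_congr_near 𝕜 hr μ y hω hB hB', symPhiRAt_congr_near 𝕜 hr μ y (fun _ _ _ => rfl) hB hB']

/-- [folklore] CONGRUENCE of `symT2At` for a root offset in the box. -/
theorem symT2At_congr_near {r : Fin d → ℕ} {L : ℕ} (hr : r ∈ box d L) {ω ω' : Form1 d (Tau 𝔸)} {B B₁ B' B₁' : Form1 d 𝔸}
    (μ : Fin d) (y : Fin d → ℤ) (hω : ∀ κ x, Near L y x → ω κ x = ω' κ x) (hB : ∀ κ x, Near L y x → B κ x = B₁ κ x)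
    (hB' : ∀ κ x, Near L y x → B' κ x = B₁' κ x) :
    symT2At 𝕜 (toSite r) ω B B' L μ y = symT2At 𝕜 (toSite r) ω' B₁ B₁' L μ y := by
  rw [symT2At, symT2At, symQjetAt_congr_near 𝕜 hr μ y hω hB hB', symQjetAt_congr_near 𝕜 hr μ y hω hB' hB]

end Qjet

/-! ## §4 The mixed chart `U_f = e^{τ₁W_f + τ₂V_f} · e^{σB_f}` (node 12b) and the symmetrised mixed jet `symMjetAt ρ` -/

section Mixed

variable (𝕜 : Type*) [Field 𝕜] {𝔸 : Type*} [Ring 𝔸] [Algebra 𝕜 𝔸]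

/-- [our object] The symmetrised rooted averaging on node 12b's mixed chart (sym twin of `PhiMAt`). -/
def symPhiMAt (ρ : Fin d → ℤ) (W V B : Form1 d 𝔸) (L : ℕ) (μ : Fin d) (y : Fin d → ℤ) : Rho 𝔸 :=
  symPhiGAt 𝕜 ρ (Gm 𝕜 W V B) (Gmb 𝕜 W V B) L μ y

/-- [our object] THE SYMMETRISED RIGHT-TRIVIALISED MIXED JET `M^{ρ,sym}_b(W, V; B)` (sym twin of `MjetAt`): the `τ₁τ₂σ`-coefficient of
`logT( Φ^{ρ,sym}_b(U) · invT Φ^{ρ,sym}_b(E) )`, `U = e^{τ₁W+τ₂V} e^{σB}`, `E = e^{σB}` (VALUES: an1's exact engine of record, OUTSIDE Lean;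
provenance only). -/
def symMjetAt (ρ : Fin d → ℤ) (W V B : Form1 d 𝔸) (L : ℕ) (μ : Fin d) (y : Fin d → ℤ) : 𝔸 :=
  c11 ((logT 𝕜 (symPhiMAt 𝕜 ρ W V B L μ y * invT (symPhiMAt 𝕜 ρ 0 0 B L μ y))).snd)

/-- [folklore] Killing `τ₁` on the symmetrised averaging kills `W`. -/
theorem k1_symPhiMAt (ρ : Fin d → ℤ) (W V B : Form1 d 𝔸) (L : ℕ) (μ : Fin d) (y : Fin d → ℤ) :
    mapDual (k1 𝕜) (symPhiMAt 𝕜 ρ W V B L μ y) = symPhiMAt 𝕜 ρ 0 V B L μ y := by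
  rw [symPhiMAt, symPhiMAt, map_symPhiGAt]; simp only [k1_Gm, k1_Gmb]; try rfl

/-- [folklore] Killing `τ₂` on the symmetrised averaging kills `V`. -/
theorem k2_symPhiMAt (ρ : Fin d → ℤ) (W V B : Form1 d 𝔸) (L : ℕ) (μ : Fin d) (y : Fin d → ℤ) :
    mapDual (k2 𝕜) (symPhiMAt 𝕜 ρ W V B L μ y) = symPhiMAt 𝕜 ρ W 0 B L μ y := by
  rw [symPhiMAt, symPhiMAt, map_symPhiGAt]; simp only [k2_Gm, k2_Gmb]; try rfl

/-- [folklore] Killing `σ` on the symmetrised averaging kills `B`. -/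
theorem kσ_symPhiMAt (ρ : Fin d → ℤ) (W V B : Form1 d 𝔸) (L : ℕ) (μ : Fin d) (y : Fin d → ℤ) :
    kσ 𝕜 (symPhiMAt 𝕜 ρ W V B L μ y) = symPhiMAt 𝕜 ρ W V 0 L μ y := by
  rw [symPhiMAt, symPhiMAt, map_symPhiGAt]; simp only [kσ_Gm, kσ_Gmb]; try rfl

/-- [folklore] **The symmetrised mixed jet VANISHES without the first fluctuation.** -/
theorem symMjetAt_W_zero (ρ : Fin d → ℤ) (V B : Form1 d 𝔸) (L : ℕ) (μ : Fin d) (y : Fin d → ℤ) :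
    symMjetAt 𝕜 ρ 0 V B L μ y = 0 := by
  have e := congrArg (fun Z : Rho 𝔸 => c11 Z.snd)
    (map_logT (mapDual (k1 𝕜)) (symPhiMAt 𝕜 ρ 0 V B L μ y * invT (symPhiMAt 𝕜 ρ 0 0 B L μ y)))
  simp only [map_mul, map_invT, k1_symPhiMAt, snd_mapDual, c11_k1] at e
  rw [symMjetAt]; exact e.symm

/-- [folklore] **The symmetrised mixed jet VANISHES without the second fluctuation.** -/
theorem symMjetAt_V_zero (ρ : Fin d → ℤ) (W B : Form1 d 𝔸) (L : ℕ) (μ : Fin d) (y : Fin d → ℤ) :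
    symMjetAt 𝕜 ρ W 0 B L μ y = 0 := by
  have e := congrArg (fun Z : Rho 𝔸 => c11 Z.snd)
    (map_logT (mapDual (k2 𝕜)) (symPhiMAt 𝕜 ρ W 0 B L μ y * invT (symPhiMAt 𝕜 ρ 0 0 B L μ y)))
  simp only [map_mul, map_invT, k2_symPhiMAt, snd_mapDual, c11_k2] at e
  rw [symMjetAt]; exact e.symm

/-- [folklore] **The symmetrised mixed jet VANISHES without the background** (`Φ(U)Φ(U)⁻¹`-trivial `σ`-slot). -/
theorem symMjetAt_B_zero (ρ : Fin d → ℤ) (W V : Form1 d 𝔸) (L : ℕ) (μ : Fin d) (y : Fin d → ℤ) :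
    symMjetAt 𝕜 ρ W V 0 L μ y = 0 := by
  have e := congrArg (fun Z : Rho 𝔸 => c11 Z.snd)
    (map_logT (kσ 𝕜) (symPhiMAt 𝕜 ρ W V 0 L μ y * invT (symPhiMAt 𝕜 ρ 0 0 0 L μ y)))
  simp only [map_mul, map_invT, kσ_symPhiMAt] at e
  simp only [kσ_apply, snd_dmk, c11_zero] at e
  rw [symMjetAt]; exact e.symm

/-- [folklore] BLOCK TRANSLATION of the symmetrised mixed averaging. -/
theorem symPhiMAt_add (ρ : Fin d → ℤ) (W V B : Form1 d 𝔸) (L : ℕ) (μ : Fin d) (y v : Fin d → ℤ) :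
    symPhiMAt 𝕜 ρ W V B L μ (y + v)
      = symPhiMAt 𝕜 ρ (shift ((L : ℤ) • v) W) (shift ((L : ℤ) • v) V) (shift ((L : ℤ) • v) B) L μ y := by
  rw [symPhiMAt, symPhiGAt_add]; rfl

/-- [folklore] BLOCK TRANSLATION of the symmetrised mixed jet. -/
theorem symMjetAt_add (ρ : Fin d → ℤ) (W V B : Form1 d 𝔸) (L : ℕ) (μ : Fin d) (y v : Fin d → ℤ) :
    symMjetAt 𝕜 ρ W V B L μ (y + v)
      = symMjetAt 𝕜 ρ (shift ((L : ℤ) • v) W) (shift ((L : ℤ) • v) V) (shift ((L : ℤ) • v) B) L μ y := by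
  rw [symMjetAt, symMjetAt, symPhiMAt_add, symPhiMAt_add]; rfl

/-- [folklore] CONGRUENCE of the symmetrised mixed averaging for a root offset in the box. -/
theorem symPhiMAt_congr_near {r : Fin d → ℕ} {L : ℕ} (hr : r ∈ box d L) {W W' V V' B B' : Form1 d 𝔸} (μ : Fin d) (y : Fin d → ℤ)
    (hW : ∀ κ x, Near L y x → W κ x = W' κ x) (hV : ∀ κ x, Near L y x → V κ x = V' κ x)
    (hB : ∀ κ x, Near L y x → B κ x = B' κ x) :
    symPhiMAt 𝕜 (toSite r) W V B L μ y = symPhiMAt 𝕜 (toSite r) W' V' B' L μ y :=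
  symPhiGAt_congr_near hr μ y (fun κ x hx => by simp only [Gm, Zf, hW κ x hx, hV κ x hx, hB κ x hx])
    (fun κ x hx => by simp only [Gmb, Zb, hW κ x hx, hV κ x hx, hB κ x hx])

/-- [folklore] CONGRUENCE of the symmetrised mixed jet for a root offset in the box: fluctuations and background may be changed off node
7a's support box `Near L y` without changing `M^{ρ,sym}_b`. -/
theorem symMjetAt_congr_near {r : Fin d → ℕ} {L : ℕ} (hr : r ∈ box d L) {W W' V V' B B' : Form1 d 𝔸} (μ : Fin d) (y : Fin d → ℤ)
    (hW : ∀ κ x, Near L y x → W κ x = W' κ x) (hV : ∀ κ x, Near L y x → V κ x = V' κ x)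
    (hB : ∀ κ x, Near L y x → B κ x = B' κ x) :
    symMjetAt 𝕜 (toSite r) W V B L μ y = symMjetAt 𝕜 (toSite r) W' V' B' L μ y := by
  rw [symMjetAt, symMjetAt, symPhiMAt_congr_near 𝕜 hr μ y hW hV hB,
    symPhiMAt_congr_near 𝕜 hr μ y (fun _ _ _ => rfl) (fun _ _ _ => rfl) hB]

end Mixed

end

end Summit.QuantumFields.BalabanUV.Beta.SymAveragingMixedJetTables
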